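import Summits.QuantumFields.BalabanUV.T4Continuum.Support.ShellMeasureAverageAnalyticB7
import Literature.MathematicalPhysics.QuantumFieldTheory.Balaban1983to89.B12PlaquetteLoop267

/-!
# `T4Continuum.ShellMeasureAverageAnalyticRegular` — S49 f2 ON THE REGULAR CONFIGURATIONS OF [Balaban1987RG1] p. 254:
# the printed block average (2.4)∕[B7] (15) in the chart is analytic ∕ `0` at `0` ∕ bounded for every UNIT-BOUNDED
# background whose PLAQUETTES satisfy `‖V(∂p) − 1‖ ≤ ε₀`, `24·d·L^{d+1}·ε₀ < 1` — the loop-level regime binder of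
# `ShellMeasureAverageAnalyticB7` DISCHARGED from plaquette regularity by `B12PlaquetteLoop267` (lattice Stokes count)
(cell `pub-balaban`, sub-cell `t4`, spine estimate NE7c (node U5b), owner lineage `b2b-balaban-t4-ne7c-p1` gen 28; answers
the crew referee's DV-26 («the regime binder … typed, wired, NOT shown»): the regime IS print's p. 254 regularity «restricted
to regular configurations U, i.e. configurations satisfying bounds |U(∂p) − 1| < ε₀, p ∈ T, with ε₀ positive and
sufficiently small», made explicit as `24dL^{d+1}ε₀ < 1`; imports S49 f2 + `B12PlaquetteLoop267` ONLY; [folklore]; 0 def,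
0 sorry)

HONEST FRAMING.  Finite four-torus programme, rung (B)+1 only — NOT infinite volume, NOT a mass gap, NOT the Clay
problem, NOT summit progress; (B), `BetaPertHyp`, (B^μ) are not consumed.  NE7c (`T4IndicatorShell.ShellWeightBound`)
is NOT PRINTED and NOT PROVED; «NE7c ⇐ the named binders».  For Bałaban's own backgrounds (the minimisers `U_k` of
the (2.18)-terms) plaquette regularity is the printed small-field∕regularity condition (B11 (19)–(21), B14 (2.16)–(2.17))
— a DISPLAYED binder of TYPE (W-a family), not discharged here.  Nothing printed is asserted.  HONEST DEPENDENCY (cell):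
continuum YM on T⁴ ⇐ BetaPertH ∧ nine spine estimates (0/9 proved); BetaPertH ⇐ (D1) ∧ (D4) ∧ CAP+tail; G-an2-4 gates
asym, D1 and NE2/3/4.

* `analyticOnNhd_Qtilde_gammaT_regular`, `norm_Qtilde_gammaT_le_regular`: S49 f2's `analyticOnNhd_Qtilde_gammaT` ∕
  `norm_Qtilde_gammaT_le` with `hW` (off-axis block loops within `ε ≤ 1∕8` of `1`) REPLACED by `h44 : ∀ p i j, i ≠ j →
  ‖plaquetteHolonomyZd V p i j − 1‖ ≤ ε₀` and `24dL^{d+1}ε₀ < 1` (`B12PlaquetteLoop267.norm_loopW_sub_one_le` +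
  `thresholds_of_small`: `ε := omegaC d L ε₀ ≤ 1∕8`); same radius `1∕(2816(d+1)L)`, same bound.
-/

noncomputable section

open Metric Set

namespace Summit.QuantumFields.BalabanUV.T4Continuum.ShellMeasureAverageAnalyticRegular

open Literature.MathematicalPhysics.QuantumFieldTheory.Balaban1983to89
open Literature.MathematicalPhysics.QuantumLattice (ZdEdge plaquetteHolonomyZd)
open B7BlockGeometry (qppBonds)
open B12HOperator267 (gammaT)
open B12AverageCorridor267 (Qtilde)
open B8Lemma1NonAbelian (omegaC omegaC_nonneg)
open B12PlaquetteLoop267 (norm_loopW_sub_one_le thresholds_of_small)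
open ShellMeasureAverageAnalyticB7 (analyticOnNhd_Qtilde_gammaT norm_Qtilde_gammaT_le)

variable {d : ℕ} {𝔸 : Type*} [NormedRing 𝔸] [NormedAlgebra ℂ 𝔸] [CompleteSpace 𝔸] [NormOneClass 𝔸]
variable {L : ℕ} {c : ZdEdge d} {V : ZdEdge d → 𝔸ˣ} {ε₀ : ℝ}

/-- **THE PRINTED AVERAGE IN THE CHART IS ANALYTIC ON THE REGULAR CONFIGURATIONS OF p. 254**: for a unit-bounded
background `V` with `‖V(∂p) − 1‖ ≤ ε₀` for every plaquette and `24dL^{d+1}ε₀ < 1`, `B ↦ Q̃_V(ext B)(c)` is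
`AnalyticOnNhd ℂ` on `ball 0 (1∕(2816(d+1)L))`. [folklore] -/
theorem analyticOnNhd_Qtilde_gammaT_regular (hL : 0 < L) (hd : 1 ≤ d) (hV : ∀ b, ‖((V b : 𝔸ˣ) : 𝔸)‖ ≤ 1)
    (hV' : ∀ b, ‖(((V b)⁻¹ : 𝔸ˣ) : 𝔸)‖ ≤ 1) (hε₀ : 0 ≤ ε₀) (hsmall : 24 * (d : ℝ) * (L : ℝ) ^ (d + 1) * ε₀ < 1)
    (h44 : ∀ (p : Fin d → ℤ) (i j : Fin d), i ≠ j → ‖((plaquetteHolonomyZd V p i j : 𝔸ˣ) : 𝔸) - 1‖ ≤ ε₀) :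
    AnalyticOnNhd ℂ (fun B : ↥(qppBonds L c) → 𝔸 =>
        Qtilde L (fun U : ZdEdge d → 𝔸ˣ => gammaT L U) V (Function.extend Subtype.val B (0 : ZdEdge d → 𝔸)) c)
      (ball 0 (1 / (2816 * ((d : ℝ) + 1) * L))) :=
  analyticOnNhd_Qtilde_gammaT hL hV hV' (omegaC_nonneg hL hd hε₀) (thresholds_of_small hL hd hε₀ hsmall).1
    (norm_loopW_sub_one_le hL V hV hV' hε₀ h44 c)

/-- **… AND BOUNDED BY `2816(d+1)L‖B‖`** there. [folklore] -/
theorem norm_Qtilde_gammaT_le_regular (hL : 0 < L) (hd : 1 ≤ d) (hV : ∀ b, ‖((V b : 𝔸ˣ) : 𝔸)‖ ≤ 1)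
    (hV' : ∀ b, ‖(((V b)⁻¹ : 𝔸ˣ) : 𝔸)‖ ≤ 1) (hε₀ : 0 ≤ ε₀) (hsmall : 24 * (d : ℝ) * (L : ℝ) ^ (d + 1) * ε₀ < 1)
    (h44 : ∀ (p : Fin d → ℤ) (i j : Fin d), i ≠ j → ‖((plaquetteHolonomyZd V p i j : 𝔸ˣ) : 𝔸) - 1‖ ≤ ε₀)
    {B : ↥(qppBonds L c) → 𝔸} (hB : ‖B‖ < 1 / (2816 * ((d : ℝ) + 1) * L)) :
    ‖Qtilde L (fun U : ZdEdge d → 𝔸ˣ => gammaT L U) V (Function.extend Subtype.val B (0 : ZdEdge d → 𝔸)) c‖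
      ≤ 2816 * ((d : ℝ) + 1) * L * ‖B‖ :=
  norm_Qtilde_gammaT_le hL hV hV' (omegaC_nonneg hL hd hε₀) (thresholds_of_small hL hd hε₀ hsmall).1
    (norm_loopW_sub_one_le hL V hV hV' hε₀ h44 c) hB

end Summit.QuantumFields.BalabanUV.T4Continuum.ShellMeasureAverageAnalyticRegular
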